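import Summits.CriticalPhenomena.PercolationContinuityZ3.Theorems.SoloInformedExitGate
import Literature.Probability.Percolation.ConnectivityProofs
import HarnessLib

/-!
# The surface tension of bond percolation vanishes at `p_c(ℤ^d)` (unconditionally)

Solo seat `solo-CriticalPhenomena-informed`, portrait items S9/S15 of the sharpest-statement
census: an UNCONDITIONAL theorem about the critical point of bond percolation on `ℤ^d`, `d ≥ 2`,
valid in both the continuity world and the (hypothetical) jump world of
`Summit.CriticalPhenomena.PercolationContinuityZ3`.

Write `Λ(n) = [-n, n]^d`, `∂ⁱⁿΛ(N)` for the inner vertex boundary of `Λ(N)`, and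
`g_t(p) = P_p(A_t)` for the probability that `0` is joined inside the half-space `ℍ = {x₀ ≥ 0}` to
height `t` (`CerfDembinVanishing.halfSpaceReach`).

* `real_compl_boxToInfinity_ge` — the finite-volume **gate inequality**: for `n ≤ N` and every
  `m`,
  `P_p(Λ(n) ↮ ∞) ≥ (1 - p)^{2dm} · (1 - |∂ⁱⁿΛ(N)| · g_{N-n}(p) / (m + 1))`.
  Mechanism (kit in `SoloInformedExitGate`): the gate `T(ω) ⊆ ∂ⁱⁿΛ(N)` of boundary sites
  joined to `Λ(n)` INSIDE `Λ(N)` only reads the edges inside `Λ(N)`; closing the `≤ 2d|T|` edges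
  leaving `Λ(N)` at `T` (independent of the inside) disconnects `Λ(n)` from `∞`;
  `E|T| ≤ |∂ⁱⁿΛ(N)| g_{N-n}` by the lattice symmetry carrying a boundary site to the apex of a
  half-space, and Markov bounds `P(|T| > m)`.
* `eventually_exp_le_real_compl_boxToInfinity` — for `d ≥ 2`, `p < 1` and every `ε > 0`,
  eventually in `n`,
  `P_p(Λ(n) ↮ ∞) ≥ exp(-(8 d² 3^{d-1} |log(1-p)| θ_ℍ(p) + ε) n^{d-1})`:
  the surface-order decay rate of the disconnection event is at most `C_d |log(1-p)| θ_ℍ(p)`.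
* `surfaceTension_vanishes_at_criticalProbI` — at `p = p_c(ℤ^d)`, `d ≥ 2`, where
  `θ_ℍ(p_c) = 0` (Barsky–Grimmett–Newman, the tree's proved `BarskyGrimmettNewman1991_holds`):
  for every `δ > 0`, eventually `P_{p_c}(Λ(n) ↮ ∞) ≥ exp(-δ n^{d-1})` — the surface tension
  vanishes at the critical point; `surfaceTension_vanishes_at_criticalProbI_three` is the case
  `d = 3`.
* `percolationContinuityZ3_iff_forall_real_compl_boxToInfinity` — the summit restated through
  these events: `θ(p_c(ℤ³)) = 0 ↔ ∀ n, P_{p_c}(Λ(n) ↮ ∞) = 1`.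

Why this is a portrait item and not a route: in the continuity world `P_{p_c}(Λ(n) ↮ ∞) = 1`; in
the jump world `P_{p_c}(Λ(n) ↮ ∞) → 0` (an infinite cluster exists a.s.) but, by this file,
never faster than `exp(-o(n^{d-1}))`.  The
statement "surface-order decay at some `p` forces surface-order decay at `p_c`" would decide the
summit and is one of its equivalent faces (census line S15/D5′).

The exit-closing mechanism (reveal the inside, close the unrevealed exits, independence) is the
standard one, e.g. Duminil-Copin–et-al., arXiv:2603.03257, eq. (41) and Remark 8.2; the input
`θ_ℍ(p_c) = 0` is Barsky–Grimmett–Newman 1991 / Grimmett 1999 Thm. (7.35).  [folklore]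
-/

noncomputable section

namespace Summit.CriticalPhenomena.PercolationContinuityZ3.Theorems

open MeasureTheory ProbabilityTheory Filter Topology
open Literature.Probability.Percolation Literature.Probability.LatticeModels
open Literature.Probability.Percolation.CerfDembinVanishing
open scoped ENNReal

namespace SurfaceTension

variable {d : ℕ}

/-! ## The gate inequality -/

/-- **Gate inequality.** For `n ≤ N` and every `m`,
`P_p(Λ(n) ↮ ∞) ≥ (1-p)^{2dm} · (1 - |∂ⁱⁿΛ(N)| · P_p(A_{N-n}) / (m+1))`. [folklore] -/
theorem real_compl_boxToInfinity_ge [NeZero d] (p : unitInterval) {n N : ℕ} (hnN : n ≤ N)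
    (m : ℕ) :
    (1 - (p : ℝ)) ^ (2 * d * m) *
        (1 - (innerBoundary (zdGraph d) (box d N)).card *
          (bondPercolation (zdGraph d) p).real (halfSpaceReach d (N - n)) / (m + 1)) ≤
      (bondPercolation (zdGraph d) p).real (boxToInfinity d n)ᶜ := by
  set μ := bondPercolation (zdGraph d) p with hμ
  set B := innerBoundary (zdGraph d) (box d N) with hB
  set 𝒯 := B.powerset.filter (fun T => T.card ≤ m) with h𝒯
  set g := μ.real (halfSpaceReach d (N - n)) with hg
  -- Step 1 (Markov + symmetry): `P(|gate| ≥ m+1) ≤ |B| g / (m+1)`.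
  have h1 : μ.real {ω | m + 1 ≤ (gate d n N ω).card} ≤ B.card * g / (m + 1) := by
    have hsum : ∑ v ∈ B, μ (linkedToBox d n N v) ≤ B.card * μ (halfSpaceReach d (N - n)) := by
      calc ∑ v ∈ B, μ (linkedToBox d n N v)
          ≤ ∑ _v ∈ B, μ (halfSpaceReach d (N - n)) :=
            Finset.sum_le_sum fun v hv => measure_linkedToBox_le_halfSpaceReach p hnN hv
        _ = B.card * μ (halfSpaceReach d (N - n)) := by rw [Finset.sum_const, nsmul_eq_mul]
    have h := (markov_gate (d := d) (n := n) (N := N) p m).trans hsum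
    have hfin : (B.card : ℝ≥0∞) * μ (halfSpaceReach d (N - n)) ≠ ∞ :=
      ENNReal.mul_ne_top (ENNReal.natCast_ne_top _) (measure_ne_top _ _)
    have hreal := ENNReal.toReal_mono hfin h
    rw [ENNReal.toReal_mul, ENNReal.toReal_mul, ENNReal.toReal_natCast,
      ENNReal.toReal_natCast] at hreal
    rw [le_div_iff₀ (by positivity : (0 : ℝ) < m + 1)]
    have hm : ((m + 1 : ℕ) : ℝ) = (m : ℝ) + 1 := by push_cast; ring
    calc μ.real {ω | m + 1 ≤ (gate d n N ω).card} * (m + 1)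
        = ((m + 1 : ℕ) : ℝ) * (μ {ω | m + 1 ≤ (gate d n N ω).card}).toReal := by
          rw [hm, measureReal_def, mul_comm]
      _ ≤ B.card * (μ (halfSpaceReach d (N - n))).toReal := hreal
      _ = B.card * g := by rw [hg, measureReal_def]
  -- Step 2: `P(|gate| ≤ m) ≥ 1 - |B| g/(m+1)`.
  have h2 : 1 - B.card * g / (m + 1) ≤ μ.real {ω | (gate d n N ω).card ≤ m} := by
    rw [setOf_card_gate_eq_compl, probReal_compl_eq_one_sub (measurableSet_card_gate_ge m)]
    linarith
  -- Step 3: sum over the values of the gate, independence inside/outside.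
  have h3 : (1 - (p : ℝ)) ^ (2 * d * m) * μ.real {ω | (gate d n N ω).card ≤ m} ≤
      μ.real (⋃ T₀ ∈ 𝒯, ({ω | gate d n N ω = T₀} ∩ exitsClosed d N T₀)) := by
    have hdisj : Set.PairwiseDisjoint (↑𝒯 : Set (Finset (Site d)))
        (fun T₀ => {ω | gate d n N ω = T₀} ∩ exitsClosed d N T₀) :=
      fun T₁ _ T₂ _ hne => Set.disjoint_left.2 fun ω h₁ h₂ => hne (h₁.1.symm.trans h₂.1)
    have hdisj' : Set.PairwiseDisjoint (↑𝒯 : Set (Finset (Site d)))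
        (fun T₀ => {ω : BondConfig (Site d) | gate d n N ω = T₀}) :=
      fun T₁ _ T₂ _ hne => Set.disjoint_left.2 fun ω h₁ h₂ => hne (h₁.symm.trans h₂)
    rw [measureReal_biUnion_finset hdisj
      (fun T₀ _ => (measurableSet_gate_eq T₀).inter (measurableSet_exitsClosed T₀))]
    have hU : μ.real {ω | (gate d n N ω).card ≤ m} =
        ∑ T₀ ∈ 𝒯, μ.real {ω | gate d n N ω = T₀} := by
      rw [← measureReal_biUnion_finset hdisj' (fun T₀ _ => measurableSet_gate_eq T₀),
        iUnion_gate_eq]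
    rw [hU, Finset.mul_sum]
    refine Finset.sum_le_sum fun T₀ hT₀ => ?_
    have hcard : T₀.card ≤ m := (Finset.mem_filter.1 hT₀).2
    rw [real_gate_eq_inter_exitsClosed, mul_comm]
    refine mul_le_mul_of_nonneg_left ?_ measureReal_nonneg
    exact (pow_le_pow_of_le_one (sub_nonneg.2 p.2.2) (sub_le_self _ p.2.1)
      (Nat.mul_le_mul_left _ hcard)).trans (pow_le_real_exitsClosed p T₀)
  -- Step 4: on that union, almost surely `Λ(n) ↮ ∞`.
  have h4 : μ.real (⋃ T₀ ∈ 𝒯, ({ω | gate d n N ω = T₀} ∩ exitsClosed d N T₀)) ≤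
      μ.real (boxToInfinity d n)ᶜ := by
    have hae : ∀ᵐ ω ∂μ, ω ⊆ (zdGraph d).edgeSet := setBernoulli_ae_subset
    simp only [measureReal_def]
    refine ENNReal.toReal_mono (measure_ne_top _ _) (measure_mono_ae ?_)
    filter_upwards [hae] with ω hω hU
    obtain ⟨T₀, -, hgate, hclosed⟩ := Set.mem_iUnion₂.1 hU
    have hgate' : gate d n N ω = T₀ := hgate
    rw [← hgate'] at hclosed
    exact not_mem_boxToInfinity hnN hω hclosed
  calc (1 - (p : ℝ)) ^ (2 * d * m) * (1 - B.card * g / (m + 1))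
      ≤ (1 - (p : ℝ)) ^ (2 * d * m) * μ.real {ω | (gate d n N ω).card ≤ m} :=
        mul_le_mul_of_nonneg_left h2 (pow_nonneg (sub_nonneg.2 p.2.2) _)
    _ ≤ _ := h3
    _ ≤ _ := h4

/-- The gate inequality with the optimal integer `m = ⌊2 |∂ⁱⁿΛ(N)| g⌋`:
`P_p(Λ(n) ↮ ∞) ≥ ½ (1-p)^{2d ⌊2|∂ⁱⁿΛ(N)| P_p(A_{N-n})⌋}`. [folklore] -/
theorem real_compl_boxToInfinity_ge_half_pow [NeZero d] (p : unitInterval) {n N : ℕ}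
    (hnN : n ≤ N) :
    (1 / 2 : ℝ) * (1 - (p : ℝ)) ^ (2 * d *
        ⌊2 * ((innerBoundary (zdGraph d) (box d N)).card : ℝ) *
          (bondPercolation (zdGraph d) p).real (halfSpaceReach d (N - n))⌋₊) ≤
      (bondPercolation (zdGraph d) p).real (boxToInfinity d n)ᶜ := by
  set B := innerBoundary (zdGraph d) (box d N) with hB
  set g := (bondPercolation (zdGraph d) p).real (halfSpaceReach d (N - n)) with hg
  set m := ⌊2 * (B.card : ℝ) * g⌋₊ with hm
  have hg0 : 0 ≤ g := measureReal_nonneg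
  have hlt : 2 * (B.card : ℝ) * g < m + 1 := Nat.lt_floor_add_one _
  have hhalf : (1 / 2 : ℝ) ≤ 1 - B.card * g / (m + 1) := by
    have : (B.card : ℝ) * g / (m + 1) ≤ 1 / 2 := by
      rw [div_le_iff₀ (by positivity : (0 : ℝ) < m + 1)]; linarith
    linarith
  calc (1 / 2 : ℝ) * (1 - (p : ℝ)) ^ (2 * d * m)
      ≤ (1 - B.card * g / (m + 1)) * (1 - (p : ℝ)) ^ (2 * d * m) :=
        mul_le_mul_of_nonneg_right hhalf (pow_nonneg (sub_nonneg.2 p.2.2) _)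
    _ = (1 - (p : ℝ)) ^ (2 * d * m) * (1 - B.card * g / (m + 1)) := mul_comm _ _
    _ ≤ _ := real_compl_boxToInfinity_ge p hnN m

/-! ## Asymptotics -/

/-- `g_k(p) = P_p(A_k)` decreases to a limit `≤ θ_ℍ(p)`. [folklore] -/
theorem exists_real_halfSpaceReach_le [NeZero d] (p : unitInterval) {η : ℝ} (hη : 0 < η) :
    ∃ k, (bondPercolation (zdGraph d) p).real (halfSpaceReach d k) ≤
      theta (halfSpaceGraph d) (halfSpaceOrigin d) p + η := by
  set μ := bondPercolation (zdGraph d) p with hμ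
  have hreal : theta (halfSpaceGraph d) (halfSpaceOrigin d) p =
      μ.real (percolatesVia (withinGraph (zdGraph d) (halfSpace d)) 0) :=
    theta_induce_eq_real_percolatesVia (zdGraph d) (halfSpace d) (0 : Site d) (zero_mem_halfSpace d) p
  have hlim := tendsto_measure_iInter_atTop (μ := μ)
    (fun n => (measurableSet_halfSpaceReach (d := d) n).nullMeasurableSet) antitone_halfSpaceReach
    ⟨0, measure_ne_top _ _⟩
  have hlim' : Tendsto (fun k => μ.real (halfSpaceReach d k)) atTop
      (𝓝 (μ.real (⋂ k, halfSpaceReach d k))) :=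
    (ENNReal.tendsto_toReal (measure_ne_top _ _)).comp hlim
  have hle : μ.real (⋂ k, halfSpaceReach d k) ≤ theta (halfSpaceGraph d) (halfSpaceOrigin d) p := by
    rw [hreal]; exact measureReal_mono iInter_halfSpaceReach_subset (measure_ne_top _ _)
  obtain ⟨k, hk⟩ := ((tendsto_order.1 hlim').2 _ (show μ.real (⋂ k, halfSpaceReach d k) <
    theta (halfSpaceGraph d) (halfSpaceOrigin d) p + η by linarith)).exists
  exact ⟨k, hk.le⟩

/-- **Surface-order lower bound for the disconnection of a box.** For `d ≥ 2`, `p < 1` and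
`ε > 0`, eventually in `n`,
`P_p(Λ(n) ↮ ∞) ≥ exp(-(8 d² 3^{d-1} · |log(1-p)| · θ_ℍ(p) + ε) · n^{d-1})`.
In words: the surface tension of the disconnection event is at most `C_d |log(1-p)| θ_ℍ(p)`.
[folklore] -/
theorem eventually_exp_le_real_compl_boxToInfinity [NeZero d] (hd : 2 ≤ d) (p : unitInterval)
    (hp1 : (p : ℝ) < 1) {ε : ℝ} (hε : 0 < ε) :
    ∀ᶠ n : ℕ in atTop,
      Real.exp (-((8 * (d : ℝ) ^ 2 * 3 ^ (d - 1)) * (-Real.log (1 - p)) *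
          theta (halfSpaceGraph d) (halfSpaceOrigin d) p + ε) * (n : ℝ) ^ (d - 1)) ≤
        (bondPercolation (zdGraph d) p).real (boxToInfinity d n)ᶜ := by
  set μ := bondPercolation (zdGraph d) p with hμ
  set L : ℝ := -Real.log (1 - p) with hL
  set θH := theta (halfSpaceGraph d) (halfSpaceOrigin d) p with hθH
  set C : ℝ := 8 * (d : ℝ) ^ 2 * 3 ^ (d - 1) with hC
  have hL0 : 0 ≤ L :=
    neg_nonneg.2 (Real.log_nonpos (sub_nonneg.2 p.2.2) (sub_le_self _ p.2.1))
  have hC0 : 0 < C := by positivity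
  have hθH0 : 0 ≤ θH := measureReal_nonneg
  -- choose the height `k`
  obtain ⟨k, hk⟩ := exists_real_halfSpaceReach_le (d := d) p (η := ε / (2 * (C * L + 1)))
    (by positivity)
  -- the two eventual conditions on `n`
  have hpow : Tendsto (fun n : ℕ => (n : ℝ) ^ (d - 1)) atTop atTop :=
    (tendsto_pow_atTop (by omega)).comp tendsto_natCast_atTop_atTop
  have hev1 : ∀ᶠ n : ℕ in atTop, Real.log 2 ≤ ε / 2 * (n : ℝ) ^ (d - 1) := by
    filter_upwards [hpow.eventually_ge_atTop (Real.log 2 / (ε / 2))] with n hn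
    rw [div_le_iff₀ (by positivity)] at hn
    linarith
  filter_upwards [hev1, eventually_ge_atTop (2 * k + 1)] with n hn1 hn2
  have hfin := real_compl_boxToInfinity_ge_half_pow (d := d) p (n := n) (N := n + k) (by omega)
  rw [Nat.add_sub_cancel_left] at hfin
  refine le_trans ?_ hfin
  set B := innerBoundary (zdGraph d) (box d (n + k)) with hB
  set g := μ.real (halfSpaceReach d k) with hg
  set m := ⌊2 * (B.card : ℝ) * g⌋₊ with hm
  have hg0 : 0 ≤ g := measureReal_nonneg
  have hm_le : (m : ℝ) ≤ 2 * B.card * g := Nat.floor_le (by positivity)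
  have hBcard : (B.card : ℝ) ≤ 2 * d * (3 * n) ^ (d - 1) := by
    have h1 : (B.card : ℝ) ≤ 2 * d * (2 * (n + k) + 1) ^ (d - 1) := by
      exact_mod_cast card_innerBoundary_box_le (d := d) (n + k)
    have h2 : (2 * ((n : ℝ) + k) + 1) ^ (d - 1) ≤ (3 * (n : ℝ)) ^ (d - 1) := by
      have : (2 * k + 1 : ℝ) ≤ n := by exact_mod_cast hn2
      exact pow_le_pow_left₀ (by positivity) (by linarith) _
    calc (B.card : ℝ) ≤ 2 * d * (2 * (n + k) + 1) ^ (d - 1) := h1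
      _ ≤ 2 * d * (3 * n) ^ (d - 1) := by gcongr
  -- the exponent estimate
  have hexp : 2 * d * (m : ℝ) * L ≤ (C * L * θH + ε / 2) * (n : ℝ) ^ (d - 1) := by
    have h3pow : (3 * (n : ℝ)) ^ (d - 1) = 3 ^ (d - 1) * (n : ℝ) ^ (d - 1) := mul_pow _ _ _
    have hfrac : C * L / (2 * (C * L + 1)) ≤ 1 / 2 := by
      rw [div_le_iff₀ (by positivity)]; linarith
    have hn0 : (0 : ℝ) ≤ (n : ℝ) ^ (d - 1) := by positivity
    calc 2 * d * (m : ℝ) * L ≤ 2 * d * (2 * B.card * g) * L := by gcongr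
      _ ≤ 2 * d * (2 * (2 * d * (3 * n) ^ (d - 1)) * g) * L := by gcongr
      _ = C * (n : ℝ) ^ (d - 1) * (g * L) := by rw [h3pow, hC]; ring
      _ ≤ C * (n : ℝ) ^ (d - 1) * ((θH + ε / (2 * (C * L + 1))) * L) := by gcongr
      _ = (C * L * θH) * (n : ℝ) ^ (d - 1) +
            (C * L / (2 * (C * L + 1))) * ε * (n : ℝ) ^ (d - 1) := by ring
      _ ≤ (C * L * θH) * (n : ℝ) ^ (d - 1) + (1 / 2) * ε * (n : ℝ) ^ (d - 1) := by
          gcongr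
      _ = (C * L * θH + ε / 2) * (n : ℝ) ^ (d - 1) := by ring
  -- conclusion
  have h1p : 0 < 1 - (p : ℝ) := by linarith
  have hpow_eq : (1 - (p : ℝ)) ^ (2 * d * m) = Real.exp (-(2 * d * (m : ℝ) * L)) := by
    rw [hL, ← Real.exp_log h1p, ← Real.exp_nat_mul, Real.log_exp]
    congr 1; push_cast; ring
  have hhalf : Real.exp (-(ε / 2 * (n : ℝ) ^ (d - 1))) ≤ 1 / 2 := by
    have h2 : (1 / 2 : ℝ) = Real.exp (-Real.log 2) := by
      rw [Real.exp_neg, Real.exp_log two_pos, one_div]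
    rw [h2]
    exact Real.exp_le_exp.2 (neg_le_neg hn1)
  calc Real.exp (-(C * L * θH + ε) * (n : ℝ) ^ (d - 1))
      = Real.exp (-(ε / 2 * (n : ℝ) ^ (d - 1))) *
          Real.exp (-((C * L * θH + ε / 2) * (n : ℝ) ^ (d - 1))) := by
        rw [← Real.exp_add]; congr 1; ring
    _ ≤ (1 / 2) * (1 - (p : ℝ)) ^ (2 * d * m) := by
        refine mul_le_mul hhalf ?_ (Real.exp_pos _).le (by norm_num)
        rw [hpow_eq]
        exact Real.exp_le_exp.2 (neg_le_neg hexp)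

/-- **The surface tension vanishes at `p_c(ℤ^d)`, `d ≥ 2`.** For every `δ > 0`, eventually in
`n`, `P_{p_c}(Λ(n) ↮ ∞) ≥ exp(-δ n^{d-1})`.  Input: `θ_ℍ(p_c) = 0`
(Barsky–Grimmett–Newman 1991; the tree's proved `BarskyGrimmettNewman1991_holds`) and
`p_c(ℤ^d) < 1`. [folklore] -/
theorem surfaceTension_vanishes_at_criticalProbI [NeZero d] (hd : 2 ≤ d) {δ : ℝ} (hδ : 0 < δ) :
    ∀ᶠ n : ℕ in atTop,
      Real.exp (-δ * (n : ℝ) ^ (d - 1)) ≤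
        (bondPercolation (zdGraph d) (criticalProbI d)).real (boxToInfinity d n)ᶜ := by
  have hp1 : ((criticalProbI d : unitInterval) : ℝ) < 1 := by
    rw [coe_criticalProbI]; exact criticalProb_zd_lt_one hd
  have hθ : theta (halfSpaceGraph d) (halfSpaceOrigin d) (criticalProbI d) = 0 :=
    BarskyGrimmettNewman1991_holds d hd
  have h := eventually_exp_le_real_compl_boxToInfinity (d := d) hd (criticalProbI d) hp1 hδ
  rw [hθ] at h
  simpa only [mul_zero, zero_add] using h

/-- **The case `d = 3`** (the summit's lattice): for every `δ > 0`, eventually in `n`,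
`P_{p_c(ℤ³)}(Λ(n) ↮ ∞) ≥ exp(-δ n²)`. [folklore] -/
theorem surfaceTension_vanishes_at_criticalProbI_three {δ : ℝ} (hδ : 0 < δ) :
    ∀ᶠ n : ℕ in atTop,
      Real.exp (-δ * (n : ℝ) ^ 2) ≤
        (bondPercolation (zdGraph 3) (criticalProbI 3)).real (boxToInfinity 3 n)ᶜ :=
  surfaceTension_vanishes_at_criticalProbI (d := 3) (by norm_num) hδ

/-! ## Link with the summit statement -/

/-- `{Λ(n) ↔ ∞} = ⋃_{x ∈ Λ(n)} {x ↔ ∞}`. -/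
theorem boxToInfinity_eq_biUnion (n : ℕ) :
    boxToInfinity d n = ⋃ x ∈ box d n, percolatesAt x := by
  ext ω
  simp only [boxToInfinity, Set.mem_setOf_eq, Set.mem_iUnion, exists_prop, percolatesAt]

/-- `{Λ(n) ↔ ∞}` is measurable. -/
theorem measurableSet_boxToInfinity (n : ℕ) : MeasurableSet (boxToInfinity d n) := by
  rw [boxToInfinity_eq_biUnion]
  exact MeasurableSet.biUnion (box d n).countable_toSet fun x _ => measurableSet_percolatesAt_holds x

/-- `θ(p_c(ℤ^d)) = 0` iff every event `Λ(n) ↔ ∞` is null at `p_c` (translation invariance,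
`theta_zdGraph_eq_theta_zero`). [folklore] -/
theorem percolationContinuity_iff_forall_boxToInfinity (d : ℕ) :
    PercolationContinuity d ↔
      ∀ n, bondPercolation (zdGraph d) (criticalProbI d) (boxToInfinity d n) = 0 := by
  constructor
  · intro h n
    rw [boxToInfinity_eq_biUnion]
    refine (measure_biUnion_null_iff (box d n).countable_toSet).2 fun x _ => ?_
    have hx : theta (zdGraph d) x (criticalProbI d) = 0 := by
      rw [theta_zdGraph_eq_theta_zero]; exact h
    rwa [theta, measureReal_eq_zero_iff (measure_ne_top _ _)] at hx
  · intro h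
    have hsub : percolatesAt (0 : Site d) ⊆ boxToInfinity d 0 :=
      fun ω hω => ⟨0, zero_mem_box d 0, hω⟩
    show (bondPercolation (zdGraph d) (criticalProbI d)).real (percolatesAt 0) = 0
    rw [measureReal_eq_zero_iff (measure_ne_top _ _)]
    exact measure_mono_null hsub (h 0)

/-- **The summit through the disconnection events**:
`PercolationContinuityZ3 ↔ ∀ n, P_{p_c(ℤ³)}(Λ(n) ↮ ∞) = 1`.  In the opposite (jump) world these
probabilities are `< 1`, yet by `surfaceTension_vanishes_at_criticalProbI_three` they exceed
`exp(-δ n²)` eventually for every `δ > 0`: the disconnection of a large box at `p_c(ℤ³)` is never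
a surface-order large deviation. [folklore] -/
theorem percolationContinuityZ3_iff_forall_real_compl_boxToInfinity :
    PercolationContinuityZ3 ↔
      ∀ n, (bondPercolation (zdGraph 3) (criticalProbI 3)).real (boxToInfinity 3 n)ᶜ = 1 := by
  rw [show PercolationContinuityZ3 ↔ PercolationContinuity 3 from Iff.rfl,
    percolationContinuity_iff_forall_boxToInfinity]
  refine forall_congr' fun n => ?_
  rw [probReal_compl_eq_one_sub (measurableSet_boxToInfinity n), sub_eq_self,
    measureReal_eq_zero_iff (measure_ne_top _ _)]

end SurfaceTension

end Summit.CriticalPhenomena.PercolationContinuityZ3.Theorems
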